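import Literature.Probability.LatticeModels.LayeredPlaneRotatorStackSusceptibilityBound
import Literature.Probability.LatticeModels.PlaneRotatorCorrelationLength
import HarnessLib

/-!
# The Hikami–Tsuneto `log²` law for weakly coupled layers as a ONE-SIDED theorem:
# `T_c^{3D}(J∥, J⊥) ≤ T₀ · (1 + B²/ln²(T₀/(A·J⊥)))` from a Kosterlitz–Thouless envelope of ONE layer

Topic `Literature/Probability/LatticeModels`. Sources: S. Hikami, T. Tsuneto, *Phase transition of quasi-two dimensional
planar system*, Prog. Theor. Phys. **63** (1980) 387 [HikamiTsuneto1980], §4 (the interlayer crossover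
`k_B T_c ≃ J⊥ (ξ(T_c)/a)²`, whence `T_c − T_KT ≃ T_KT · b/ln²(J/J⊥)`); J. M. Kosterlitz, J. Phys. C **7** (1974) 1046
[Kosterlitz1974], §3 (`ξ(T) ∼ exp(b/√(T/T_KT − 1))`, `χ ∼ ξ^{2−η}`); L. L. Liu, H. E. Stanley, Phys. Rev. Lett. **29**
(1972) 927 [LiuStanley1972], p. 272 (the layers `(J, J, εJ)` and the interlayer mean-field estimate of `T_c(ε)`);
B. Simon, Comm. Math. Phys. **77** (1980) 111 [Simon1980CMP], Thm 1.3; E. H. Lieb, ibid. 127 [Lieb1980], eq. (23) —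
the rigorous RPA bound of the tree (`LayeredPlaneRotatorStackSusceptibilityBound.lean`:
`χ^{3D} ≤ χ₂/(1 − βJ⊥χ₂)`, `ofReal_le_layeredSusceptibilityCriticalCoupling_of_forall_interlayer`).

## What is proved

The classical layered XY (plane-rotator) comparison model on `ℤ³` with in-plane reduced coupling `K = βJ∥` and
interlayer coupling `ΔK = βJ⊥` (`Δ = J⊥/J∥`); `χ₂(K) := ∑_{z ∈ ℤ²} G^{2D,free,∞}_K(0, z)` is the susceptibility of ONE
free layer (`PlaneRotator.infTwoPoint K 2 0 ·`), `K_χ^{3D}(Δ)` the stack's susceptibility transition coupling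
(`PlaneRotator.layeredSusceptibilityCriticalCoupling`, `T_χ^{3D}(J∥, ΔJ∥) = J∥/K_χ^{3D}(Δ)`), `K_χ(2)` the layer's.

* **§1 lattice sums in the plane** (exact shell count `|∂Λ_k| = 8k` of `ℤ²`, tree `card_sphere_succ_add`):
  `sum_box_two_pow_supNorm` (`∑_{z ∈ Λ_n} q^{‖z‖_∞} = 1 + 8∑_{k<n}(k+1)q^{k+1}`), **`tsum_pow_supNorm_two_le`**
  (`∑_{z ∈ ℤ²} q^{‖z‖_∞} ≤ 1 + 8q/(1 − q)²`, `0 ≤ q < 1`), and the correlation-length form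
  **`tsum_exp_neg_norm_div_two_le`**: `∑_{z ∈ ℤ²} e^{−‖z‖_∞/ξ} ≤ 1 + 8(ξ + 1)²` (`1/(1 − e^{−1/ξ}) ≤ 1 + ξ`).
* **§2 a decay envelope of the layer is a susceptibility ceiling**: if `G^{2D}_K(0, z) ≤ C·e^{−‖z‖_∞/ξ}` for all `z`
  then `χ₂(K) < ∞` and **`χ₂(K) ≤ C·(1 + 8(ξ + 1)²)`** (`tsum_infTwoPoint_le_of_corrLength`; rate form
  `tsum_infTwoPoint_le_of_exp_decay`); dictionary with the tree's typed correlation length `ξ₂(K) = 1/massGap K 2`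
  (`PlaneRotatorCorrelationLength.lean`): the envelope `(C, ξ)` is an `ℓ^∞` decay rate `1/ξ`, so `ξ₂(K) ≤ ξ`
  (`ofReal_inv_le_massGap_of_corrLength`), and `ξ₂(K) < ∞` supplies SOME envelope (`exists_corrLength_of_massGap_pos`).
* **§3 THE INTERLAYER CRITERION IN CORRELATION-LENGTH CURRENCY** — Hikami–Tsuneto's heuristic `k_BT_c ≈ J⊥(ξ/a)²` made
  one-sided with explicit constants: **`ofReal_le_layeredSusceptibilityCriticalCoupling_of_corrLength`**:
  `Δ·K·C·(1 + 8(ξ + 1)²) < 1 ⇒ K ≤ K_χ^{3D}(Δ)` whenever the layer at coupling `K` has the envelope `(C, ξ)`; in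
  temperature units (`ofReal_div_le_layeredSusceptibilityCriticalCoupling_of_corrLength`):
  `J⊥ · C(1 + 8(ξ₂(T) + 1)²) < T ⇒ T_χ^{3D}(J∥, J⊥) ≤ T` — and with it every ordering temperature of the stack (§6).
* **§4 THE `log²` LAW (susceptibility envelope).** Let `K₀ > 0`, `A > 0`, `B ≥ 0` and suppose the Kosterlitz–Thouless
  envelope `χ₂(K) < ∞`, `χ₂(K) ≤ A·exp(B·√(K/(K₀ − K)))` for every `0 ≤ K < K₀` (in temperature units, `T₀ := J∥/K₀`:
  `χ₂(T) ≤ A·e^{B/√(T/T₀ − 1)}` on `(T₀, ∞)`). Then for every `Δ > 0` with `A·K₀·Δ < 1`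
  (**`ofReal_le_layeredSusceptibilityCriticalCoupling_of_ktEnvelope`**):

    `K₀ / (1 + B²/ln²(1/(A K₀ Δ))) ≤ K_χ^{3D}(Δ)`,   i.e.   `T_χ^{3D}(J∥, ΔJ∥) ≤ T₀ · (1 + B²/ln²(T₀/(A J⊥)))`

  (`layeredSusceptibilityTemperature_le_of_ktEnvelope`); the envelope itself puts `K₀ ≤ K_χ(2)`
  (`ofReal_le_susceptibilityCriticalCoupling_of_ktEnvelope`), and the RATE COROLLARY
  **`toReal_susceptibilityCriticalCoupling_sub_le_of_ktEnvelope`**: if the envelope holds up to the layer's own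
  transition (`K₀ = K_χ(2) < ∞`) then `0 ≤ K_χ(2) − K_χ^{3D}(Δ) ≤ K_χ(2)·B²/(B² + ln²(1/(A K_χ(2) Δ)))` — the stack's
  transition coupling approaches the layer's at least as fast as `1/ln²(1/Δ)` (the lower inequality is the tree's
  `layeredSusceptibilityCriticalCoupling_le`, Griffiths–Ginibre).
* **§5 THE `log²` LAW (correlation-length envelope)**, Hikami–Tsuneto's own currency: a uniform prefactor `C` and
  `ξ₂(K) ≤ A′·exp(B′·√(K/(K₀ − K)))` give the same with `b = (2B′)²` and `A = C(1 + 8(A′ + 1)²)`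
  (`ofReal_le_layeredSusceptibilityCriticalCoupling_of_ktCorrLengthEnvelope`).
* **§6 every ordering temperature** (the tree's canonical Borel structure on `Circle`): the same couplings lie below the
  stack's stiffness transition coupling `K_Υ^{3D}(Δ, i)` in EVERY twist direction (tree
  `layeredSusceptibilityCriticalCoupling_le_layeredStiffnessCriticalCoupling`), so c-axis and in-plane stack stiffness,
  long-range order and the susceptibility divergence all set in at or below `T₀(1 + B²/ln²(T₀/(A J⊥)))`.

## Reading (cell `pub/hubbard-tc`, MO-S3, §2.4 G2 «2D → 3D ordering», ASSUMPTIONS keys I1 (A5) / K4-c; classical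
comparison model, number-neutral)

Key I1 models the 3D ordering of weakly coupled layers by the layered-XY scaling law `T_c = T_KT·(1 + b/ln²(J/J⊥))`
(`b = O(1)`, Monte Carlo / RG floats). This file shows that the UPPER half of that law is not an independent modelling
input: GIVEN any Kosterlitz–Thouless envelope of the single comparison layer — `χ₂(T) ≤ A·e^{B/√(T/T₀−1)}`, or
`ξ₂(T) ≤ A′·e^{B′/√(T/T₀−1)}` with a uniform prefactor — EVERY ordering temperature of the layered comparison model
obeys `T_c^{3D}(J∥, J⊥) ≤ T₀·(1 + B²/ln²(T₀/(A·J⊥)))` for `J⊥ < T₀/A`, with `b = B²` (`= 4B′²` in correlation-length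
currency) and the logarithm's argument fixed by the envelope's prefactor: a COROLLARY of the rigorous RPA bound
`χ^{3D} ≤ χ₂/(1 − βJ⊥χ₂)` and the envelope. The envelope is the Kosterlitz–Thouless picture of ONE layer — a
hypothesis here (exactly I1's physics input), never certified: no certified `χ₂`/`ξ₂` of the 2D XY layer near `T_KT`
exists in the tree or in print.

NOT CLAIMED: that any envelope holds (key K4-c's status is unchanged); the LOWER half of the `log²` law
(`T_c^{3D} ≥ T_KT(1 + b′/ln²)`: it needs a lower bound on `χ^{3D}` beyond Griffiths' `χ^{3D} ≥ χ₂`, or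
Fröhlich–Spencer-type input); `K_χ(2) < ∞` (Fröhlich–Spencer, a named hypothesis elsewhere in the tree); anything about
the quantum XY or Hubbard models; no `T_c`, kelvin, row or token of record. WHAT THIS IS NOT: a value of `b`; a
statement about a material.

Presearch (cell rule): none in print as a theorem — corpus hybrid/vector search («rigorous upper bound transition
temperature weakly coupled layers logarithm squared interlayer coupling Hikami Tsuneto») returns Friedli–Velenik
pp. 452/473 (generic) and physics texts; galaxy («Hikami and Tsuneto|weakly coupled layers|ln^2(J/J'») returns
Hansen–Lemmich–Ipsen–Mouritsen, J. Stat. Phys. 73 (1993) (two coupled Ising planes, MC/mean field) and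
Feinberg–Theodorakis, PRB 49 (1994) (physics). The printed twin is Hikami–Tsuneto's §4 estimate (heuristic); the
rigorous ingredient is the tree's RPA bound.
-/

noncomputable section

open MeasureTheory Finset Filter
open scoped BigOperators Topology ENNReal

namespace Literature.Probability.LatticeModels

namespace PlaneRotator

/-! ## §1 Lattice sums in the plane: `∑_{z ∈ ℤ²} q^{‖z‖_∞} = 1 + 8q/(1 − q)²` -/

section LatticeSum

/-- **The shells of `ℤ²`**: `|∂Λ_{k+1}| = |Λ_{k+1}| − |Λ_k| = (2k+3)² − (2k+1)² = 8(k+1)`.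
[cite: FriedliVelenik2017, §3.2 (the boxes B(n))] -/
theorem card_sphere_two_succ (k : ℕ) : #(sphere 2 (k + 1)) = 8 * (k + 1) := by
  have h := card_sphere_succ_add (d := 2) k
  rw [card_box, card_box] at h
  have e : (2 * (k + 1) + 1) ^ 2 = 8 * (k + 1) + (2 * k + 1) ^ 2 := by ring
  rw [e] at h
  exact Nat.add_right_cancel h

/-- **Box sums by shells**: `∑_{z ∈ Λ_n} q^{‖z‖_∞} = 1 + 8·∑_{k<n} (k+1)·q^{k+1}` on `ℤ²` (the origin, then the shells
`|∂Λ_{k+1}| = 8(k+1)`). [cite: FriedliVelenik2017, §3.2 (the boxes B(n))] -/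
theorem sum_box_two_pow_supNorm (q : ℝ) (n : ℕ) :
    ∑ z ∈ box 2 n, q ^ Site.supNorm z = 1 + 8 * ∑ k ∈ Finset.range n, ((k : ℝ) + 1) * q ^ (k + 1) := by
  classical
  induction n with
  | zero =>
    rw [Finset.sum_range_zero, mul_zero, add_zero]
    have h : ∀ z ∈ box 2 0, q ^ Site.supNorm z = 1 := fun z hz => by
      rw [Nat.le_zero.1 (mem_box_iff_supNorm_le.1 hz), pow_zero]
    rw [Finset.sum_congr rfl h, Finset.sum_const, card_box]
    simp
  | succ n ih =>
    rw [← Finset.sum_sdiff (box_mono 2 (Nat.le_succ n)), ← sphere_succ_eq_sdiff, ih, Finset.sum_range_succ]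
    have h : ∀ z ∈ sphere 2 (n + 1), q ^ Site.supNorm z = q ^ (n + 1) := fun z hz => by rw [mem_sphere.1 hz]
    rw [Finset.sum_congr rfl h, Finset.sum_const, card_sphere_two_succ, nsmul_eq_mul]
    push_cast
    ring

/-- **Finite partial sums**: for `0 ≤ q < 1` and every finite `F ⊂ ℤ²`, `∑_{z ∈ F} q^{‖z‖_∞} ≤ 1 + 8q/(1 − q)²`
(`F ⊆ Λ_n`, the shell sum, and `∑_k k q^k = q/(1 − q)²`). [cite: Simon1980CMP, Thm 1.3 (exponential decay summed over the lattice)] -/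
theorem sum_pow_supNorm_two_le {q : ℝ} (hq0 : 0 ≤ q) (hq1 : q < 1) (F : Finset (Site 2)) :
    ∑ z ∈ F, q ^ Site.supNorm z ≤ 1 + 8 * (q / (1 - q) ^ 2) := by
  classical
  set n := F.sup Site.supNorm with hn
  have hF : F ⊆ box 2 n := fun z hz => mem_box_iff_supNorm_le.2 (Finset.le_sup (f := Site.supNorm) hz)
  have hnorm : ‖q‖ < 1 := by rw [Real.norm_of_nonneg hq0]; exact hq1
  have hsum : HasSum (fun k : ℕ => (k : ℝ) * q ^ k) (q / (1 - q) ^ 2) :=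
    hasSum_coe_mul_geometric_of_norm_lt_one hnorm
  have hle : ∑ k ∈ Finset.range (n + 1), (k : ℝ) * q ^ k ≤ q / (1 - q) ^ 2 :=
    sum_le_hasSum (Finset.range (n + 1)) (fun k _ => mul_nonneg k.cast_nonneg (pow_nonneg hq0 k)) hsum
  calc ∑ z ∈ F, q ^ Site.supNorm z ≤ ∑ z ∈ box 2 n, q ^ Site.supNorm z :=
        Finset.sum_le_sum_of_subset_of_nonneg hF fun z _ _ => pow_nonneg hq0 _
    _ = 1 + 8 * ∑ k ∈ Finset.range n, ((k : ℝ) + 1) * q ^ (k + 1) := sum_box_two_pow_supNorm q n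
    _ = 1 + 8 * ∑ k ∈ Finset.range (n + 1), (k : ℝ) * q ^ k := by
        rw [Finset.sum_range_succ']
        simp
    _ ≤ 1 + 8 * (q / (1 - q) ^ 2) := by linarith

/-- `z ↦ q^{‖z‖_∞}` is summable over `ℤ²` for `0 ≤ q < 1`. [cite: Simon1980CMP, Thm 1.3] -/
theorem summable_pow_supNorm_two {q : ℝ} (hq0 : 0 ≤ q) (hq1 : q < 1) :
    Summable fun z : Site 2 => q ^ Site.supNorm z :=
  summable_of_sum_le (fun _ => pow_nonneg hq0 _) (sum_pow_supNorm_two_le hq0 hq1)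

/-- **`∑_{z ∈ ℤ²} q^{‖z‖_∞} ≤ 1 + 8q/(1 − q)²`** for `0 ≤ q < 1` (in fact equality: `1 + ∑_{k ≥ 1} 8k q^k`).
[cite: Simon1980CMP, Thm 1.3 (exponential decay summed over the lattice)] -/
theorem tsum_pow_supNorm_two_le {q : ℝ} (hq0 : 0 ≤ q) (hq1 : q < 1) :
    ∑' z : Site 2, q ^ Site.supNorm z ≤ 1 + 8 * (q / (1 - q) ^ 2) :=
  Real.tsum_le_of_sum_le (fun _ => pow_nonneg hq0 _) (sum_pow_supNorm_two_le hq0 hq1)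

/-- `e^{−m‖z‖} = (e^{−m})^{‖z‖_∞}` (the norm on `ℤ^ν` is the `ℓ^∞` norm). [folklore] -/
private theorem exp_neg_mul_norm_eq_pow {ν : ℕ} (m : ℝ) (z : Site ν) :
    Real.exp (-m * ‖z‖) = Real.exp (-m) ^ Site.supNorm z := by
  rw [Site.norm_eq_supNorm, mul_comm, Real.exp_nat_mul]

/-- **`∑_{z ∈ ℤ²} e^{−m‖z‖_∞} ≤ 1 + 8e^{−m}/(1 − e^{−m})²`** for `m > 0` (with summability).
[cite: Simon1980CMP, Thm 1.3 (exponential decay summed over the lattice)] -/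
theorem tsum_exp_neg_mul_norm_two_le {m : ℝ} (hm : 0 < m) :
    (Summable fun z : Site 2 => Real.exp (-m * ‖z‖)) ∧
      ∑' z : Site 2, Real.exp (-m * ‖z‖) ≤ 1 + 8 * (Real.exp (-m) / (1 - Real.exp (-m)) ^ 2) := by
  have hq0 : 0 ≤ Real.exp (-m) := (Real.exp_pos _).le
  have hq1 : Real.exp (-m) < 1 := Real.exp_lt_one_iff.2 (by linarith)
  simp_rw [exp_neg_mul_norm_eq_pow]
  exact ⟨summable_pow_supNorm_two hq0 hq1, tsum_pow_supNorm_two_le hq0 hq1⟩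

/-- `1/(1 − e^{−m}) ≤ 1 + 1/m` for `m > 0` (from `1 + m ≤ e^m`): with `ξ = 1/m`, `1/(1 − e^{−1/ξ}) ≤ 1 + ξ`. [folklore] -/
private theorem one_div_one_sub_exp_neg_le {m : ℝ} (hm : 0 < m) : 1 / (1 - Real.exp (-m)) ≤ 1 + 1 / m := by
  have hq0 : 0 ≤ Real.exp (-m) := (Real.exp_pos _).le
  have h1 : Real.exp (-m) < 1 := Real.exp_lt_one_iff.2 (by linarith)
  have hpos : 0 < 1 - Real.exp (-m) := by linarith
  have hexp : m + 1 ≤ Real.exp m := Real.add_one_le_exp m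
  have hprod : Real.exp m * Real.exp (-m) = 1 := by rw [← Real.exp_add, add_neg_cancel, Real.exp_zero]
  have hle : (m + 1) * Real.exp (-m) ≤ 1 := by
    calc (m + 1) * Real.exp (-m) ≤ Real.exp m * Real.exp (-m) := mul_le_mul_of_nonneg_right hexp hq0
      _ = 1 := hprod
  rw [div_le_iff₀ hpos]
  have hm' : m * 1 ≤ m * ((1 + 1 / m) * (1 - Real.exp (-m))) := by
    rw [show m * ((1 + 1 / m) * (1 - Real.exp (-m))) = m + 1 - (m + 1) * Real.exp (-m) by field_simp]
    linarith
  exact le_of_mul_le_mul_left hm' hm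

/-- `e^{−m}/(1 − e^{−m})² ≤ (1 + 1/m)²` for `m > 0`. [folklore] -/
private theorem exp_neg_div_sq_le {m : ℝ} (hm : 0 < m) :
    Real.exp (-m) / (1 - Real.exp (-m)) ^ 2 ≤ (1 + 1 / m) ^ 2 := by
  have h1 : Real.exp (-m) < 1 := Real.exp_lt_one_iff.2 (by linarith)
  have hpos : 0 < 1 - Real.exp (-m) := by linarith
  calc Real.exp (-m) / (1 - Real.exp (-m)) ^ 2 ≤ 1 / (1 - Real.exp (-m)) ^ 2 :=
        div_le_div_of_nonneg_right h1.le (by positivity)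
    _ = (1 / (1 - Real.exp (-m))) ^ 2 := by rw [one_div_pow]
    _ ≤ (1 + 1 / m) ^ 2 := pow_le_pow_left₀ (by positivity) (one_div_one_sub_exp_neg_le hm) 2

/-- **Correlation-length form: `∑_{z ∈ ℤ²} e^{−‖z‖_∞/ξ} ≤ 1 + 8(ξ + 1)²`** for `ξ > 0` (with summability) — the
leading `8ξ²` is the sharp asymptotics of `1 + 8q/(1 − q)²`, `q = e^{−1/ξ}`.
[cite: Simon1980CMP, Thm 1.3 (exponential decay summed over the lattice); HikamiTsuneto1980, §4 (the area ξ² of a correlated patch)] -/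
theorem tsum_exp_neg_norm_div_two_le {ξ : ℝ} (hξ : 0 < ξ) :
    (Summable fun z : Site 2 => Real.exp (-(‖z‖ / ξ))) ∧
      ∑' z : Site 2, Real.exp (-(‖z‖ / ξ)) ≤ 1 + 8 * (ξ + 1) ^ 2 := by
  have hm : 0 < 1 / ξ := by positivity
  have heq : ∀ z : Site 2, Real.exp (-(‖z‖ / ξ)) = Real.exp (-(1 / ξ) * ‖z‖) := fun z => by
    congr 1
    ring
  simp_rw [heq]
  obtain ⟨hs, ht⟩ := tsum_exp_neg_mul_norm_two_le hm
  refine ⟨hs, ht.trans ?_⟩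
  have h := exp_neg_div_sq_le hm
  rw [one_div_one_div] at h
  nlinarith [h]

end LatticeSum

/-! ## §2 A decay envelope of the layer is a susceptibility ceiling -/

section Envelope

variable [MeasurableSpace Circle] [BorelSpace Circle]

/-- **Rate form**: if the free two-dimensional two-point function at coupling `K ≥ 0` obeys
`G^{2D}_K(0, z) ≤ C·e^{−m‖z‖_∞}` for all `z` (`m > 0`), then `χ₂(K) < ∞` and
`χ₂(K) ≤ C·(1 + 8e^{−m}/(1 − e^{−m})²)`. [cite: Simon1980CMP, Thm 1.3 (mass gap ⇒ finite susceptibility)] -/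
theorem tsum_infTwoPoint_le_of_exp_decay {K C m : ℝ} (hK : 0 ≤ K) (hm : 0 < m)
    (h : ∀ z : Site 2, infTwoPoint K 2 0 z ≤ C * Real.exp (-m * ‖z‖)) :
    (Summable fun z : Site 2 => infTwoPoint K 2 0 z) ∧
      ∑' z : Site 2, infTwoPoint K 2 0 z ≤ C * (1 + 8 * (Real.exp (-m) / (1 - Real.exp (-m)) ^ 2)) := by
  obtain ⟨hs, ht⟩ := tsum_exp_neg_mul_norm_two_le hm
  have hC : 0 ≤ C := by
    have h0 := h 0
    rw [norm_zero, mul_zero, Real.exp_zero, mul_one] at h0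
    exact (infTwoPoint_nonneg hK 0 0).trans h0
  have hsum : Summable fun z : Site 2 => infTwoPoint K 2 0 z :=
    Summable.of_nonneg_of_le (fun z => infTwoPoint_nonneg hK 0 z) h (hs.mul_left C)
  refine ⟨hsum, ?_⟩
  calc ∑' z : Site 2, infTwoPoint K 2 0 z ≤ ∑' z : Site 2, C * Real.exp (-m * ‖z‖) :=
        Summable.tsum_le_tsum h hsum (hs.mul_left C)
    _ = C * ∑' z : Site 2, Real.exp (-m * ‖z‖) := tsum_mul_left
    _ ≤ C * (1 + 8 * (Real.exp (-m) / (1 - Real.exp (-m)) ^ 2)) := mul_le_mul_of_nonneg_left ht hC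

/-- **Correlation-length form: `G^{2D}_K(0, z) ≤ C·e^{−‖z‖_∞/ξ}` for all `z` (`ξ > 0`, `K ≥ 0`) ⇒ `χ₂(K) < ∞` and
`χ₂(K) ≤ C·(1 + 8(ξ + 1)²)`** — a correlation length of the layer, with its prefactor, is a susceptibility ceiling.
[cite: Simon1980CMP, Thm 1.3 (mass gap ⇒ finite susceptibility); HikamiTsuneto1980, §4] -/
theorem tsum_infTwoPoint_le_of_corrLength {K C ξ : ℝ} (hK : 0 ≤ K) (hξ : 0 < ξ)
    (h : ∀ z : Site 2, infTwoPoint K 2 0 z ≤ C * Real.exp (-(‖z‖ / ξ))) :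
    (Summable fun z : Site 2 => infTwoPoint K 2 0 z) ∧
      ∑' z : Site 2, infTwoPoint K 2 0 z ≤ C * (1 + 8 * (ξ + 1) ^ 2) := by
  obtain ⟨hs, ht⟩ := tsum_exp_neg_norm_div_two_le hξ
  have hC : 0 ≤ C := by
    have h0 := h 0
    rw [norm_zero, zero_div, neg_zero, Real.exp_zero, mul_one] at h0
    exact (infTwoPoint_nonneg hK 0 0).trans h0
  have hsum : Summable fun z : Site 2 => infTwoPoint K 2 0 z :=
    Summable.of_nonneg_of_le (fun z => infTwoPoint_nonneg hK 0 z) h (hs.mul_left C)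
  refine ⟨hsum, ?_⟩
  calc ∑' z : Site 2, infTwoPoint K 2 0 z ≤ ∑' z : Site 2, C * Real.exp (-(‖z‖ / ξ)) :=
        Summable.tsum_le_tsum h hsum (hs.mul_left C)
    _ = C * ∑' z : Site 2, Real.exp (-(‖z‖ / ξ)) := tsum_mul_left
    _ ≤ C * (1 + 8 * (ξ + 1) ^ 2) := mul_le_mul_of_nonneg_left ht hC

/-- **Dictionary with the typed correlation length**: the envelope `G^{2D}_K(0, z) ≤ C·e^{−‖z‖_∞/ξ}` (`ξ > 0`,
`K ≥ 0`) is an `ℓ^∞` exponential decay rate `1/ξ` with constant `C`, so `1/ξ ≤ massGap K 2` — the layer's typed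
correlation length `ξ₂(K) = 1/massGap K 2` is at most `ξ`. [cite: FriedliVelenik2017, §3.7.4 eq. (3.68); Simon1980CMP, Thm 1.3] -/
theorem ofReal_inv_le_massGap_of_corrLength {K C ξ : ℝ} (hK : 0 ≤ K) (hξ : 0 < ξ)
    (h : ∀ z : Site 2, infTwoPoint K 2 0 z ≤ C * Real.exp (-(‖z‖ / ξ))) :
    ENNReal.ofReal (1 / ξ) ≤ massGap K 2 := by
  refine ofReal_le_massGap ⟨by positivity, C, fun z => ?_⟩
  rw [abs_of_nonneg (infTwoPoint_nonneg hK 0 z), show -(1 / ξ) * ‖z‖ = -(‖z‖ / ξ) by ring]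
  exact h z

/-- **… and conversely, qualitatively**: a finite typed correlation length (`massGap K 2 > 0`, i.e. `K` in the layer's
high-temperature phase) supplies SOME envelope `(C, ξ)` — with an unspecified prefactor `C`, which is why the
quantitative statements below carry `C` as an explicit hypothesis. [cite: FriedliVelenik2017, §3.7.4 eq. (3.68); Simon1980CMP, Thm 1.3] -/
theorem exists_corrLength_of_massGap_pos {K : ℝ} (h : 0 < massGap K 2) :
    ∃ C ξ : ℝ, 0 < ξ ∧ ∀ z : Site 2, infTwoPoint K 2 0 z ≤ C * Real.exp (-(‖z‖ / ξ)) := by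
  obtain ⟨C, m, hm, hC⟩ := massGap_pos_iff.1 h
  refine ⟨C, 1 / m, by positivity, fun z => ?_⟩
  rw [show -(‖z‖ / (1 / m)) = -m * ‖z‖ by field_simp]
  exact (le_abs_self _).trans (hC z)

/-! ## §3 The interlayer criterion in correlation-length currency: `J⊥ · C(1 + 8(ξ₂ + 1)²) < T ⇒ no 3D order` -/

/-- **Hikami–Tsuneto's crossover criterion `k_BT_c ≈ J⊥(ξ/a)²`, one-sidedly with explicit constants.** If the free layer
at coupling `K ≥ 0` has `G^{2D}_K(0, z) ≤ C·e^{−‖z‖_∞/ξ}` for all `z` (`ξ > 0`) and `Δ·K·C·(1 + 8(ξ + 1)²) < 1`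
(`Δ = J⊥/J∥ ≥ 0`), then `K ≤ K_χ^{3D}(Δ)`: the stack's susceptibility is finite at `(K, ΔK)` and at every smaller
coupling (through `χ₂(K) ≤ C(1 + 8(ξ+1)²)` and the tree's RPA bound `Δ·K·χ₂(K) < 1 ⇒ K ≤ K_χ^{3D}(Δ)`).
[cite: HikamiTsuneto1980, §4 (k_BT_c ≃ J⊥ξ²); LiuStanley1972, p. 272; Lieb1980, eq. (23); Simon1980CMP, Thm 1.3] -/
theorem ofReal_le_layeredSusceptibilityCriticalCoupling_of_corrLength {Δ K C ξ : ℝ} (hΔ : 0 ≤ Δ) (hK : 0 ≤ K)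
    (hξ : 0 < ξ) (h : ∀ z : Site 2, infTwoPoint K 2 0 z ≤ C * Real.exp (-(‖z‖ / ξ)))
    (hA : Δ * K * (C * (1 + 8 * (ξ + 1) ^ 2)) < 1) :
    ENNReal.ofReal K ≤ layeredSusceptibilityCriticalCoupling Δ := by
  obtain ⟨hs, ht⟩ := tsum_infTwoPoint_le_of_corrLength hK hξ h
  exact ofReal_le_layeredSusceptibilityCriticalCoupling_of_interlayer hΔ hK hs
    ((mul_le_mul_of_nonneg_left ht (mul_nonneg hΔ hK)).trans_lt hA)

/-- **Temperature units.** `T > 0`, `J∥ > 0`, `J⊥ ≥ 0`; if the free layer at `K = J∥/T` has the envelope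
`G^{2D}_{J∥/T}(0, z) ≤ C·e^{−‖z‖_∞/ξ}` and **`J⊥ · C·(1 + 8(ξ + 1)²) < T`**, then `J∥/T ≤ K_χ^{3D}(J⊥/J∥)` — the stack's
susceptibility transition temperature is `≤ T`: `T_χ^{3D}(J∥, J⊥) ≤ T` whenever `J⊥·C(1 + 8(ξ₂(T) + 1)²) < T`.
[cite: HikamiTsuneto1980, §4 (k_BT_c ≃ J⊥ξ²); LiuStanley1972, p. 272; Simon1980CMP, Thm 1.3] -/
theorem ofReal_div_le_layeredSusceptibilityCriticalCoupling_of_corrLength {T Jp Jz C ξ : ℝ} (hT : 0 < T)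
    (hp : 0 < Jp) (hz : 0 ≤ Jz) (hξ : 0 < ξ)
    (h : ∀ z : Site 2, infTwoPoint (Jp / T) 2 0 z ≤ C * Real.exp (-(‖z‖ / ξ)))
    (hA : Jz * (C * (1 + 8 * (ξ + 1) ^ 2)) < T) :
    ENNReal.ofReal (Jp / T) ≤ layeredSusceptibilityCriticalCoupling (Jz / Jp) := by
  refine ofReal_le_layeredSusceptibilityCriticalCoupling_of_corrLength (div_nonneg hz hp.le)
    (div_nonneg hp.le hT.le) hξ h ?_
  have heq : Jz / Jp * (Jp / T) = Jz / T := by field_simp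
  rw [heq, div_mul_eq_mul_div, div_lt_one hT]
  exact hA

/-! ## §4 The `log²` law from a Kosterlitz–Thouless susceptibility envelope of the layer -/

/-- **The Hikami–Tsuneto `log²` law, upper half, as a theorem.** Let `K₀ > 0`, `A > 0`, `B ≥ 0`, and suppose the single
free layer obeys the Kosterlitz–Thouless envelope

  `χ₂(K) < ∞` and `χ₂(K) ≤ A · exp(B · √(K/(K₀ − K)))`   for every `0 ≤ K < K₀`

(`= A·e^{B/√(T/T₀ − 1)}` with `T₀ = J∥/K₀`, `T = J∥/K`). Then for every anisotropy `Δ > 0` with `A·K₀·Δ < 1`: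

  `K₀ / (1 + B² / ln²(1/(A K₀ Δ))) ≤ K_χ^{3D}(Δ)`.

Proof: with `L = ln(1/(AK₀Δ)) > 0`, every `K < K₀/(1 + B²/L²)` has `B²·K/(K₀ − K) < L²`, so
`Δ K χ₂(K) ≤ Δ K₀ A e^{B√(K/(K₀−K))} < Δ K₀ A e^{L} = 1`, and the tree's interval form of the RPA bound applies.
[cite: HikamiTsuneto1980, §4 (T_c − T_KT ∝ T_KT/ln²(J/J⊥)); Kosterlitz1974, §3 (ξ ∼ exp(b t^{-1/2}), χ ∼ ξ^{2−η}); LiuStanley1972, p. 272; Lieb1980, eq. (23); Simon1980CMP, Thm 1.3] -/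
theorem ofReal_le_layeredSusceptibilityCriticalCoupling_of_ktEnvelope {K₀ A B Δ : ℝ} (hK₀ : 0 < K₀)
    (hA : 0 < A) (hB : 0 ≤ B)
    (henv : ∀ K : ℝ, 0 ≤ K → K < K₀ → (Summable fun z : Site 2 => infTwoPoint K 2 0 z) ∧
      ∑' z : Site 2, infTwoPoint K 2 0 z ≤ A * Real.exp (B * Real.sqrt (K / (K₀ - K))))
    (hΔ : 0 < Δ) (hΔA : A * K₀ * Δ < 1) :
    ENNReal.ofReal (K₀ / (1 + B ^ 2 / Real.log (1 / (A * K₀ * Δ)) ^ 2)) ≤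
      layeredSusceptibilityCriticalCoupling Δ := by
  set L := Real.log (1 / (A * K₀ * Δ)) with hL
  have hP : 0 < A * K₀ * Δ := by positivity
  have hL0 : 0 < L := Real.log_pos ((one_lt_div hP).2 (by linarith))
  have hexpL : Real.exp L = 1 / (A * K₀ * Δ) := Real.exp_log (by positivity)
  have hx : 0 ≤ B ^ 2 / L ^ 2 := by positivity
  have hden : 0 < 1 + B ^ 2 / L ^ 2 := by linarith
  refine ofReal_le_layeredSusceptibilityCriticalCoupling_of_forall_interlayer hΔ.le fun K hK hKc => ?_
  -- `K < K₀`
  have hKlt : K * (1 + B ^ 2 / L ^ 2) < K₀ := (lt_div_iff₀ hden).1 hKc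
  have hKx : K * (B ^ 2 / L ^ 2) < K₀ - K := by nlinarith [hKlt]
  have hKK₀ : K < K₀ := by nlinarith [mul_nonneg hK hx]
  obtain ⟨hs, hχ⟩ := henv K hK hKK₀
  refine ⟨hs, ?_⟩
  -- `B·√(K/(K₀ − K)) < L`
  have hgap : 0 < K₀ - K := sub_pos.2 hKK₀
  set u := K / (K₀ - K) with hu
  have hu0 : 0 ≤ u := div_nonneg hK hgap.le
  have hBu : B ^ 2 * u < L ^ 2 := by
    have h2 : u * (B ^ 2 / L ^ 2) < 1 := by
      rw [hu, div_mul_eq_mul_div, div_lt_one hgap]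
      exact hKx
    have hL2 : 0 < L ^ 2 := by positivity
    have h3 := mul_lt_mul_of_pos_right h2 hL2
    rw [one_mul] at h3
    calc B ^ 2 * u = u * (B ^ 2 / L ^ 2) * L ^ 2 := by field_simp
      _ < L ^ 2 := h3
  have hBsq : (B * Real.sqrt u) ^ 2 < L ^ 2 := by
    rw [mul_pow, Real.sq_sqrt hu0]
    exact hBu
  have hBlt : B * Real.sqrt u < L :=
    (pow_lt_pow_iff_left₀ (mul_nonneg hB (Real.sqrt_nonneg u)) hL0.le two_ne_zero).1 hBsq
  have hexp : Real.exp (B * Real.sqrt u) < 1 / (A * K₀ * Δ) := by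
    rw [← hexpL]
    exact Real.exp_lt_exp.2 hBlt
  -- the chain `Δ K χ₂(K) ≤ Δ K₀ A e^{B√u} < Δ K₀ A · 1/(A K₀ Δ) = 1`
  have hΔK : 0 ≤ Δ * K := mul_nonneg hΔ.le hK
  have hE0 : 0 ≤ A * Real.exp (B * Real.sqrt u) := by positivity
  calc Δ * K * ∑' z : Site 2, infTwoPoint K 2 0 z ≤ Δ * K * (A * Real.exp (B * Real.sqrt u)) :=
        mul_le_mul_of_nonneg_left hχ hΔK
    _ ≤ Δ * K₀ * (A * Real.exp (B * Real.sqrt u)) :=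
        mul_le_mul_of_nonneg_right (mul_le_mul_of_nonneg_left hKK₀.le hΔ.le) hE0
    _ < Δ * K₀ * (A * (1 / (A * K₀ * Δ))) := by
        have hΔK₀A : 0 < Δ * K₀ * A := by positivity
        have := mul_lt_mul_of_pos_left hexp hΔK₀A
        calc Δ * K₀ * (A * Real.exp (B * Real.sqrt u)) = Δ * K₀ * A * Real.exp (B * Real.sqrt u) := by ring
          _ < Δ * K₀ * A * (1 / (A * K₀ * Δ)) := this
          _ = Δ * K₀ * (A * (1 / (A * K₀ * Δ))) := by ring
    _ = 1 := by field_simp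

/-- **In temperature units: `T_χ^{3D}(J∥, ΔJ∥) ≤ T₀ · (1 + B²/ln²(1/(A K₀ Δ)))`, `T₀ = J∥/K₀`** — the stack's
susceptibility transition temperature `J∥/K_χ^{3D}(Δ)` exceeds the envelope's reference temperature `T₀` by at most the
Hikami–Tsuneto `log²` correction with `b = B²` (the statement is trivial for `J∥ ≤ 0`).
[cite: HikamiTsuneto1980, §4 (T_c − T_KT ∝ T_KT/ln²(J/J⊥)); Kosterlitz1974, §3; LiuStanley1972, p. 272] -/
theorem layeredSusceptibilityTemperature_le_of_ktEnvelope (Jp : ℝ) {K₀ A B Δ : ℝ} (hK₀ : 0 < K₀)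
    (hA : 0 < A) (hB : 0 ≤ B)
    (henv : ∀ K : ℝ, 0 ≤ K → K < K₀ → (Summable fun z : Site 2 => infTwoPoint K 2 0 z) ∧
      ∑' z : Site 2, infTwoPoint K 2 0 z ≤ A * Real.exp (B * Real.sqrt (K / (K₀ - K))))
    (hΔ : 0 < Δ) (hΔA : A * K₀ * Δ < 1) :
    ENNReal.ofReal Jp / layeredSusceptibilityCriticalCoupling Δ ≤
      ENNReal.ofReal (Jp / K₀ * (1 + B ^ 2 / Real.log (1 / (A * K₀ * Δ)) ^ 2)) := by
  have hx : 0 ≤ B ^ 2 / Real.log (1 / (A * K₀ * Δ)) ^ 2 := by positivity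
  have hc : 0 < K₀ / (1 + B ^ 2 / Real.log (1 / (A * K₀ * Δ)) ^ 2) := by positivity
  calc ENNReal.ofReal Jp / layeredSusceptibilityCriticalCoupling Δ
      ≤ ENNReal.ofReal Jp / ENNReal.ofReal (K₀ / (1 + B ^ 2 / Real.log (1 / (A * K₀ * Δ)) ^ 2)) :=
        ENNReal.div_le_div_left
          (ofReal_le_layeredSusceptibilityCriticalCoupling_of_ktEnvelope hK₀ hA hB henv hΔ hΔA) _
    _ = ENNReal.ofReal (Jp / (K₀ / (1 + B ^ 2 / Real.log (1 / (A * K₀ * Δ)) ^ 2))) :=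
        (ENNReal.ofReal_div_of_pos hc).symm
    _ = ENNReal.ofReal (Jp / K₀ * (1 + B ^ 2 / Real.log (1 / (A * K₀ * Δ)) ^ 2)) := by
        congr 1
        field_simp

/-- **The envelope's reference coupling lies below the layer's transition: `K₀ ≤ K_χ(2)`** (`T₀ ≥ T_χ^{2D}(J∥)`) — the
envelope asserts a finite layer susceptibility on `[0, K₀)`. [cite: Simon1980CMP, Thm 1.3; Kosterlitz1974, §3] -/
theorem ofReal_le_susceptibilityCriticalCoupling_of_ktEnvelope {K₀ A B : ℝ}
    (henv : ∀ K : ℝ, 0 ≤ K → K < K₀ → (Summable fun z : Site 2 => infTwoPoint K 2 0 z) ∧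
      ∑' z : Site 2, infTwoPoint K 2 0 z ≤ A * Real.exp (B * Real.sqrt (K / (K₀ - K)))) :
    ENNReal.ofReal K₀ ≤ susceptibilityCriticalCoupling 2 :=
  ofReal_le_susceptibilityCriticalCoupling_of_forall_lt fun K hK hKK₀ => (henv K hK hKK₀).1

/-- **Rate form in real numbers**: under the envelope, for `Δ > 0` with `A K₀ Δ < 1` and a finite `K_χ^{3D}(Δ)`,
`K₀ − K_χ^{3D}(Δ) ≤ K₀ · B²/(B² + ln²(1/(A K₀ Δ)))` — at most a `1/ln²(1/Δ)` below `K₀`.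
[cite: HikamiTsuneto1980, §4; Kosterlitz1974, §3; LiuStanley1972, p. 272] -/
theorem sub_toReal_layeredSusceptibilityCriticalCoupling_le_of_ktEnvelope {K₀ A B Δ : ℝ} (hK₀ : 0 < K₀)
    (hA : 0 < A) (hB : 0 ≤ B)
    (henv : ∀ K : ℝ, 0 ≤ K → K < K₀ → (Summable fun z : Site 2 => infTwoPoint K 2 0 z) ∧
      ∑' z : Site 2, infTwoPoint K 2 0 z ≤ A * Real.exp (B * Real.sqrt (K / (K₀ - K))))
    (hΔ : 0 < Δ) (hΔA : A * K₀ * Δ < 1) (htop : layeredSusceptibilityCriticalCoupling Δ ≠ ⊤) :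
    K₀ - (layeredSusceptibilityCriticalCoupling Δ).toReal ≤
      K₀ * B ^ 2 / (B ^ 2 + Real.log (1 / (A * K₀ * Δ)) ^ 2) := by
  set L := Real.log (1 / (A * K₀ * Δ)) with hL
  have hP : 0 < A * K₀ * Δ := by positivity
  have hL0 : 0 < L := Real.log_pos ((one_lt_div hP).2 (by linarith))
  have h := (ENNReal.ofReal_le_iff_le_toReal htop).1
    (ofReal_le_layeredSusceptibilityCriticalCoupling_of_ktEnvelope hK₀ hA hB henv hΔ hΔA)
  have heq : K₀ / (1 + B ^ 2 / L ^ 2) = K₀ - K₀ * B ^ 2 / (B ^ 2 + L ^ 2) := by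
    have hL2 : L ^ 2 ≠ 0 := by positivity
    have hBL : B ^ 2 + L ^ 2 ≠ 0 := by positivity
    field_simp
    ring
  rw [heq] at h
  linarith

/-- **RATE COROLLARY: the stack's transition coupling approaches the layer's at least as fast as `1/ln²(1/Δ)`.** If the
layer's transition coupling is finite (`K_χ(2) < ∞`, Fröhlich–Spencer) and the Kosterlitz–Thouless envelope holds up to
it — `χ₂(K) ≤ A·exp(B·√(K/(K_χ(2) − K)))` for every `0 ≤ K < K_χ(2)` (`χ₂ < ∞` there is automatic) — then for every
`Δ > 0` with `A·K_χ(2)·Δ < 1`: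

  `0 ≤ K_χ(2) − K_χ^{3D}(Δ) ≤ K_χ(2) · B²/(B² + ln²(1/(A K_χ(2) Δ)))`

(lower: a layer sits below the stack, tree `layeredSusceptibilityCriticalCoupling_le`; upper: §4). In temperature units
`T_χ^{2D} ≤ T_χ^{3D}(J∥, ΔJ∥) ≤ T_χ^{2D}·(1 + B²/ln²(T_χ^{2D}/(A J⊥)))`: the one-sided Hikami–Tsuneto law about the
layer's OWN transition temperature. [cite: HikamiTsuneto1980, §4 (T_c − T_KT ∝ T_KT/ln²(J/J⊥)); Kosterlitz1974, §3; LiuStanley1972, p. 272 (T_c(ε) → T_c(0)); Simon1980CMP, Thm 1.3] -/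
theorem toReal_susceptibilityCriticalCoupling_sub_le_of_ktEnvelope (htop : susceptibilityCriticalCoupling 2 ≠ ⊤)
    {A B Δ : ℝ} (hA : 0 < A) (hB : 0 ≤ B)
    (henv : ∀ K : ℝ, 0 ≤ K → K < (susceptibilityCriticalCoupling 2).toReal →
      ∑' z : Site 2, infTwoPoint K 2 0 z ≤
        A * Real.exp (B * Real.sqrt (K / ((susceptibilityCriticalCoupling 2).toReal - K))))
    (hΔ : 0 < Δ) (hΔA : A * (susceptibilityCriticalCoupling 2).toReal * Δ < 1) :
    0 ≤ (susceptibilityCriticalCoupling 2).toReal - (layeredSusceptibilityCriticalCoupling Δ).toReal ∧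
      (susceptibilityCriticalCoupling 2).toReal - (layeredSusceptibilityCriticalCoupling Δ).toReal ≤
        (susceptibilityCriticalCoupling 2).toReal * B ^ 2 /
          (B ^ 2 + Real.log (1 / (A * (susceptibilityCriticalCoupling 2).toReal * Δ)) ^ 2) := by
  set K₀ := (susceptibilityCriticalCoupling 2).toReal with hK₀def
  have hK₀ : 0 < K₀ := ENNReal.toReal_pos susceptibilityCriticalCoupling_two_pos.ne' htop
  have hle := layeredSusceptibilityCriticalCoupling_le (Δ := Δ) hΔ.le
  have htop' : layeredSusceptibilityCriticalCoupling Δ ≠ ⊤ := ne_top_of_le_ne_top htop hle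
  have henv' : ∀ K : ℝ, 0 ≤ K → K < K₀ → (Summable fun z : Site 2 => infTwoPoint K 2 0 z) ∧
      ∑' z : Site 2, infTwoPoint K 2 0 z ≤ A * Real.exp (B * Real.sqrt (K / (K₀ - K))) :=
    fun K hK hKK₀ => ⟨summable_infTwoPoint_of_ofReal_lt hK ((ENNReal.ofReal_lt_iff_lt_toReal hK htop).2 hKK₀),
      henv K hK hKK₀⟩
  exact ⟨sub_nonneg.2 (ENNReal.toReal_mono htop hle),
    sub_toReal_layeredSusceptibilityCriticalCoupling_le_of_ktEnvelope hK₀ hA hB henv' hΔ hΔA htop'⟩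

/-! ## §5 The `log²` law from a Kosterlitz–Thouless correlation-length envelope (Hikami–Tsuneto's currency) -/

/-- **The `log²` law from a correlation-length envelope.** Let `K₀ > 0`, `C > 0`, `A′, B′ ≥ 0`, and suppose that for every
`0 ≤ K < K₀` the free layer has a correlation length `ξ = ξ(K) > 0` with `ξ ≤ A′·exp(B′·√(K/(K₀ − K)))`
(Kosterlitz's `ξ ∼ e^{b/√t}`) and the uniform envelope `G^{2D}_K(0, z) ≤ C·e^{−‖z‖_∞/ξ}`. Then with
`A := C·(1 + 8(A′ + 1)²)` and `b := (2B′)²`, for every `Δ > 0` with `A·K₀·Δ < 1`: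
`K₀/(1 + (2B′)²/ln²(1/(A K₀ Δ))) ≤ K_χ^{3D}(Δ)` — §4 with the susceptibility envelope `χ₂ ≤ C(1 + 8(ξ+1)²) ≤ A·e^{2B′√(K/(K₀−K))}`
of §2. [cite: HikamiTsuneto1980, §4 (k_BT_c ≃ J⊥ξ², T_c − T_KT ∝ T_KT/ln²(J/J⊥)); Kosterlitz1974, §3 (ξ ∼ exp(b t^{-1/2})); LiuStanley1972, p. 272; Simon1980CMP, Thm 1.3] -/
theorem ofReal_le_layeredSusceptibilityCriticalCoupling_of_ktCorrLengthEnvelope {K₀ C A' B' Δ : ℝ}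
    (hK₀ : 0 < K₀) (hC : 0 < C) (hA' : 0 ≤ A') (hB' : 0 ≤ B')
    (henv : ∀ K : ℝ, 0 ≤ K → K < K₀ → ∃ ξ : ℝ, 0 < ξ ∧ ξ ≤ A' * Real.exp (B' * Real.sqrt (K / (K₀ - K))) ∧
      ∀ z : Site 2, infTwoPoint K 2 0 z ≤ C * Real.exp (-(‖z‖ / ξ)))
    (hΔ : 0 < Δ) (hΔA : C * (1 + 8 * (A' + 1) ^ 2) * K₀ * Δ < 1) :
    ENNReal.ofReal (K₀ / (1 + (2 * B') ^ 2 / Real.log (1 / (C * (1 + 8 * (A' + 1) ^ 2) * K₀ * Δ)) ^ 2)) ≤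
      layeredSusceptibilityCriticalCoupling Δ := by
  refine ofReal_le_layeredSusceptibilityCriticalCoupling_of_ktEnvelope hK₀ (A := C * (1 + 8 * (A' + 1) ^ 2))
    (B := 2 * B') (by positivity) (by positivity) (fun K hK hKK₀ => ?_) hΔ hΔA
  obtain ⟨ξ, hξ, hξle, hdec⟩ := henv K hK hKK₀
  obtain ⟨hs, hχ⟩ := tsum_infTwoPoint_le_of_corrLength hK hξ hdec
  refine ⟨hs, hχ.trans ?_⟩
  set E := Real.exp (B' * Real.sqrt (K / (K₀ - K))) with hE
  have hE1 : 1 ≤ E := Real.one_le_exp (mul_nonneg hB' (Real.sqrt_nonneg _))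
  have hE2 : Real.exp (2 * B' * Real.sqrt (K / (K₀ - K))) = E ^ 2 := by
    rw [hE, ← Real.exp_nat_mul]
    congr 1
    push_cast
    ring
  have hξ1 : ξ + 1 ≤ (A' + 1) * E := by nlinarith [hξle, hE1, hA']
  have hsq : (ξ + 1) ^ 2 ≤ ((A' + 1) * E) ^ 2 := pow_le_pow_left₀ (by linarith) hξ1 2
  have hE3 : 1 ≤ E ^ 2 := by nlinarith [hE1]
  calc C * (1 + 8 * (ξ + 1) ^ 2) ≤ C * (1 + 8 * ((A' + 1) * E) ^ 2) := by gcongr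
    _ ≤ C * (E ^ 2 + 8 * ((A' + 1) * E) ^ 2) := by gcongr
    _ = C * (1 + 8 * (A' + 1) ^ 2) * E ^ 2 := by ring
    _ = C * (1 + 8 * (A' + 1) ^ 2) * Real.exp (2 * B' * Real.sqrt (K / (K₀ - K))) := by rw [hE2]

end Envelope

/-! ## §6 Every ordering temperature of the stack (the tree's canonical Borel structure on `Circle`)

As in `LayeredPlaneRotatorStackSusceptibilityBound.lean` §8: the stack stiffness objects
(`AnisotropicRotator.layeredStiffnessCriticalCoupling`) live at the tree's global instance, so the instance-generic
theorems above are used at that instance here (no local `[MeasurableSpace Circle]` binder). -/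

section GlobalInstance

/-- **The `log²` law for EVERY ordering temperature**: under the Kosterlitz–Thouless susceptibility envelope of §4, for
every `Δ > 0` with `A K₀ Δ < 1` and every twist direction `i` (in-plane `e₁, e₂`, c-axis `e₃`):
`K₀/(1 + B²/ln²(1/(A K₀ Δ))) ≤ K_Υ^{3D}(Δ, i)` — the stack carries no stiffness in any direction (and, being in its
finite-susceptibility phase, no long-range order) at any temperature above `T₀·(1 + B²/ln²(T₀/(A J⊥)))` (tree
`K_χ^{3D}(Δ) ≤ K_Υ^{3D}(Δ, i)`). [cite: HikamiTsuneto1980, §4; FisherBarberJasnow1973, §II eq. (2.5); LiuStanley1972, p. 272] -/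
theorem ofReal_le_layeredStiffnessCriticalCoupling_of_ktEnvelope {K₀ A B Δ : ℝ} (hK₀ : 0 < K₀) (hA : 0 < A)
    (hB : 0 ≤ B)
    (henv : ∀ K : ℝ, 0 ≤ K → K < K₀ → (Summable fun z : Site 2 => infTwoPoint K 2 0 z) ∧
      ∑' z : Site 2, infTwoPoint K 2 0 z ≤ A * Real.exp (B * Real.sqrt (K / (K₀ - K))))
    (hΔ : 0 < Δ) (hΔA : A * K₀ * Δ < 1) (i : Fin 3) :
    ENNReal.ofReal (K₀ / (1 + B ^ 2 / Real.log (1 / (A * K₀ * Δ)) ^ 2)) ≤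
      AnisotropicRotator.layeredStiffnessCriticalCoupling Δ i :=
  (ofReal_le_layeredSusceptibilityCriticalCoupling_of_ktEnvelope hK₀ hA hB henv hΔ hΔA).trans
    (AnisotropicRotator.layeredSusceptibilityCriticalCoupling_le_layeredStiffnessCriticalCoupling hΔ.le i)

/-- **The correlation-length criterion for EVERY ordering temperature**: if the free layer at coupling `K ≥ 0` has the
envelope `G^{2D}_K(0, z) ≤ C·e^{−‖z‖_∞/ξ}` and `Δ·K·C·(1 + 8(ξ + 1)²) < 1` (`Δ ≥ 0`), then `K ≤ K_Υ^{3D}(Δ, i)` in every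
twist direction `i`: no stack stiffness (c-axis or in-plane) at `(K, ΔK)`.
[cite: HikamiTsuneto1980, §4 (k_BT_c ≃ J⊥ξ²); FisherBarberJasnow1973, §II eq. (2.5); LiuStanley1972, p. 272] -/
theorem ofReal_le_layeredStiffnessCriticalCoupling_of_corrLength {Δ K C ξ : ℝ} (hΔ : 0 ≤ Δ) (hK : 0 ≤ K)
    (hξ : 0 < ξ) (h : ∀ z : Site 2, infTwoPoint K 2 0 z ≤ C * Real.exp (-(‖z‖ / ξ)))
    (hA : Δ * K * (C * (1 + 8 * (ξ + 1) ^ 2)) < 1) (i : Fin 3) :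
    ENNReal.ofReal K ≤ AnisotropicRotator.layeredStiffnessCriticalCoupling Δ i :=
  (ofReal_le_layeredSusceptibilityCriticalCoupling_of_corrLength hΔ hK hξ h hA).trans
    (AnisotropicRotator.layeredSusceptibilityCriticalCoupling_le_layeredStiffnessCriticalCoupling hΔ i)

end GlobalInstance

end PlaneRotator

end Literature.Probability.LatticeModels

end
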